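import Summits.ValiantsHypothesis.ValiantsHypothesis.Theorems.KPlusLogSqLawStaticTridiagonalDefs
import Summits.ValiantsHypothesis.ValiantsHypothesis.Theorems.KPlusLogSqLawStaticPathTrainDefs
import Summits.ValiantsHypothesis.ValiantsHypothesis.Theorems.KPlusLogSqLawBandwidthOnePerm
import Summits.ValiantsHypothesis.ValiantsHypothesis.Theorems.MatrixDescartes.Negative.MatrixDescartesFalseOfTropicalMonster

/-!
# Route «KPlusLogSqLaw» — the tropical weight of a static band-one term is «diagonal + sum of item lines over its swap set»

HONEST FRAMING.  Helper toward the crux `WeakLifting` (item `stmt-ValiantsHypothesis-19561`, route `KPlusLogSqLaw`, cell `pub-symmetroid`,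
seat val-sym-lift-p3 g6, 2026-08-27) on the line of its witness-plan stub `stub_tridiagonalSectorB`: step (T3) of the transfer of the kernel
static-path `O(n log n)` law (`…StaticPathFold.chain_le`) to dominant chains of STATIC TRIDIAGONAL designs.  For a Leibniz term `(σ, λ)`
of BANDWIDTH ONE (`|σ c − c| ≤ 1`, as forced by a tridiagonal presence pattern) whose classes are read off a class table
(`λ c = cls (σ c) c`, as forced by a STATIC design), the tree's tropical weight `tropWeight d v θ (σ, λ)` equals the diagonal score
`Σ_c (θ·d(cls c c) − v c c (cls c c))` plus the sum over the SWAP SET of `σ` (`StaticTridiagonal.swapSet`, an independent set of the path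
`1..m−1` by `BandOne`) of the ITEM LINES `itemSlope·θ + itemIcpt` (`tropWeight_eq_diag_add_items`) — i.e. exactly the objective of the
parametric maximum-weight independent-set problem of `…StaticPathOptDefs` with `W (itemSlope cls d) (itemIcpt cls v)`.  Remaining steps
(T4: dominant ⇒ unique maximiser over independent sets; T5: discharge of the non-degeneracy condition by scaling and perturbing) are recorded
in HOME/val-sym-lift-p3/g6/FOLD-LEMMA-AND-WIDTH2-TRELLIS-liftp3g6.md §A2.  Nothing here asserts anything about `WeakLifting`, `TropicalB`,
`KPlusLogSqLaw`, the stub in its window, `MatrixDescartes` (stmt-ValiantsHypothesis-18050) or `VP ≠ VNP`.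
-/

set_option linter.dupNamespace false
set_option autoImplicit false

namespace Summit.ValiantsHypothesis.ValiantsHypothesis.Theorems.KPlusLogSqLaw

open Finset Classical
open Summit.ValiantsHypothesis.ValiantsHypothesis.Theorems.MatrixDescartes.Negative

namespace StaticTridiagonal

noncomputable section

variable {m K : ℕ}

/-! ## 1. The extension to `ℕ` of a bandwidth-one permutation -/

/-- `extN` at an index below `m`. [folklore] -/
theorem extN_of_lt (σ : Equiv.Perm (Fin m)) {t : ℕ} (h : t < m) : extN σ t = ((σ ⟨t, h⟩ : Fin m) : ℕ) := by
  unfold extN; rw [dif_pos h]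

/-- `extN` stays below `m` on indices below `m`. [folklore] -/
theorem extN_lt (σ : Equiv.Perm (Fin m)) {t : ℕ} (h : t < m) : extN σ t < m := by
  rw [extN_of_lt σ h]; exact Fin.isLt _

/-- `extN` on a `Fin m` value. [folklore] -/
theorem extN_val (σ : Equiv.Perm (Fin m)) (i : Fin m) : extN σ i = ((σ i : Fin m) : ℕ) := by
  rw [extN_of_lt σ i.isLt]

/-- bandwidth one, transported: `extN σ (extN σ t) = t`. [folklore] -/
theorem extN_extN {σ : Equiv.Perm (Fin m)} (hb : ∀ u : Fin m, (σ u : ℕ) ≤ u + 1 ∧ (u : ℕ) ≤ σ u + 1) {t : ℕ} (h : t < m) :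
    extN σ (extN σ t) = t := by
  rw [extN_of_lt σ h, extN_val, BandOne.sq_eq_self hb]

/-- bandwidth one, transported: the trichotomy fixed / opener / closer. [folklore] -/
theorem extN_trichotomy {σ : Equiv.Perm (Fin m)} (hb : ∀ u : Fin m, (σ u : ℕ) ≤ u + 1 ∧ (u : ℕ) ≤ σ u + 1) {t : ℕ} (h : t < m) :
    extN σ t = t ∨ extN σ t = t + 1 ∨ extN σ t + 1 = t := by
  rw [extN_of_lt σ h]
  have := hb ⟨t, h⟩
  simp only at this
  omega

/-! ## 2. The swap set -/

/-- membership in the swap set. [folklore] -/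
theorem mem_swapSet {σ : Equiv.Perm (Fin m)} {t : ℕ} : t ∈ swapSet σ ↔ (1 ≤ t ∧ t ≤ m - 1) ∧ extN σ (t - 1) = t := by
  unfold swapSet; rw [mem_filter, mem_Ioc]; constructor
  · rintro ⟨⟨h1, h2⟩, h3⟩; exact ⟨⟨h1, h2⟩, h3⟩
  · rintro ⟨⟨h1, h2⟩, h3⟩; exact ⟨⟨h1, h2⟩, h3⟩

/-- the swap set of a bandwidth-one permutation is an independent set of the path `1, …, m-1`
(in the vocabulary of `…StaticPathOptDefs`: it lies in `Ioc 0 (m-1)` and contains no two consecutive items). [folklore] -/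
theorem swapSet_indep {σ : Equiv.Perm (Fin m)} (hb : ∀ u : Fin m, (σ u : ℕ) ≤ u + 1 ∧ (u : ℕ) ≤ σ u + 1) :
    swapSet σ ⊆ Ioc 0 (m - 1) ∧ ∀ t ∈ swapSet σ, t + 1 ∉ swapSet σ := by
  refine ⟨fun t ht => mem_Ioc.mpr (mem_swapSet.mp ht).1, fun t ht ht1 => ?_⟩
  obtain ⟨⟨h1, h2⟩, h3⟩ := mem_swapSet.mp ht
  obtain ⟨⟨_, h5⟩, h6⟩ := mem_swapSet.mp ht1
  -- `σ (t-1) = t` and `σ t = t + 1`; but `σ (σ (t-1)) = t - 1`, i.e. `σ t = t - 1`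
  rw [Nat.add_sub_cancel] at h6
  have h7 := extN_extN hb (t := t - 1) (by omega)
  rw [h3, h6] at h7
  omega

/-! ## 3. The weight decomposition -/

/-- the score of entry `(r, c)` at parameter `θ`. [folklore] -/
theorem score_fin (cls : Fin m → Fin m → Fin K) (d : Fin K → ℕ) (v : Fin m → Fin m → Fin K → ℤ) (θ : ℝ) (r c : Fin m) :
    θ * dN cls d r c - vN cls v r c = θ * (d (cls r c) : ℝ) - (v r c (cls r c) : ℝ) := by
  unfold dN vN
  rw [dif_pos ⟨r.isLt, c.isLt⟩, dif_pos ⟨r.isLt, c.isLt⟩]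

/-- the tropical weight of a term whose classes are read off the class table, as a sum of entry scores. [folklore] -/
theorem tropWeight_eq_sum_score (cls : Fin m → Fin m → Fin K) (d : Fin K → ℕ) (v : Fin m → Fin m → Fin K → ℤ) (θ : ℤ)
    (σ : Equiv.Perm (Fin m)) (la : Fin m → Fin K) (hcls : ∀ c, la c = cls (σ c) c) :
    (tropWeight d v θ (σ, la) : ℝ) = ∑ c : Fin m, ((θ : ℝ) * dN cls d (extN σ c) c - vN cls v (extN σ c) c) := by
  unfold tropWeight
  push_cast
  rw [Finset.mul_sum, ← Finset.sum_sub_distrib]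
  refine Finset.sum_congr rfl fun c _ => ?_
  have h1 : extN σ c = ((σ c : Fin m) : ℕ) := extN_val σ c
  have h2 : (⟨extN σ c, h1 ▸ (σ c).isLt⟩ : Fin m) = σ c := Fin.ext h1
  rw [show dN cls d (extN σ c) c = dN cls d (σ c) c from by rw [← h2],
    show vN cls v (extN σ c) c = vN cls v (σ c) c from by rw [← h2], score_fin, hcls c]

/-- **WEIGHT DECOMPOSITION.**  For a bandwidth-one term with classes read off the class table,
`tropWeight = (diagonal score) + Σ_{t ∈ swapSet σ} (itemSlope t · θ + itemIcpt t)`. [folklore] -/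
theorem tropWeight_eq_diag_add_items (cls : Fin m → Fin m → Fin K) (d : Fin K → ℕ) (v : Fin m → Fin m → Fin K → ℤ) (θ : ℤ)
    (σ : Equiv.Perm (Fin m)) (la : Fin m → Fin K) (hb : ∀ u : Fin m, (σ u : ℕ) ≤ u + 1 ∧ (u : ℕ) ≤ σ u + 1)
    (hcls : ∀ c, la c = cls (σ c) c) :
    (tropWeight d v θ (σ, la) : ℝ) =
      (∑ c : Fin m, ((θ : ℝ) * dN cls d c c - vN cls v c c)) +
        ∑ t ∈ swapSet σ, (itemSlope cls d t * θ + itemIcpt cls v t) := by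
  rw [tropWeight_eq_sum_score cls d v θ σ la hcls]
  -- scores as functions on `ℕ`
  set G : ℕ → ℕ → ℝ := fun r c => (θ : ℝ) * dN cls d r c - vN cls v r c with hG
  -- pass to sums over `range m`
  have e1 : ∑ c : Fin m, ((θ : ℝ) * dN cls d (extN σ c) c - vN cls v (extN σ c) c) = ∑ c ∈ range m, G (extN σ c) c :=
    Fin.sum_univ_eq_sum_range (fun c => G (extN σ c) c) m
  have e2 : ∑ c : Fin m, ((θ : ℝ) * dN cls d c c - vN cls v c c) = ∑ c ∈ range m, G c c :=
    Fin.sum_univ_eq_sum_range (fun c => G c c) m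
  rw [e1, e2]
  -- it suffices to compute the sum of the differences `h c = G (σ c) c - G c c`
  suffices hkey : ∑ c ∈ range m, (G (extN σ c) c - G c c) = ∑ t ∈ swapSet σ, (itemSlope cls d t * θ + itemIcpt cls v t) by
    rw [Finset.sum_sub_distrib] at hkey; linarith
  -- split `range m` into fixed columns, openers and closers
  set O := (range m).filter (fun c => extN σ c = c + 1) with hO
  set C := (range m).filter (fun c => extN σ c + 1 = c) with hC
  have hsplit : ∑ c ∈ range m, (G (extN σ c) c - G c c) = ∑ c ∈ O, (G (extN σ c) c - G c c) + ∑ c ∈ C, (G (extN σ c) c - G c c) := by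
    rw [← Finset.sum_filter_add_sum_filter_not (range m) (fun c => extN σ c = c)]
    have hz : ∑ c ∈ (range m).filter (fun c => extN σ c = c), (G (extN σ c) c - G c c) = 0 :=
      Finset.sum_eq_zero fun c hc => by rw [(mem_filter.mp hc).2, sub_self]
    rw [hz, zero_add]
    have hOC : (range m).filter (fun c => ¬ extN σ c = c) = O ∪ C := by
      ext c
      rw [mem_union, hO, hC, mem_filter, mem_filter, mem_filter, mem_range]
      constructor
      · rintro ⟨hc, hne⟩
        rcases extN_trichotomy hb hc with h | h | h
        · exact absurd h hne
        · exact Or.inl ⟨hc, h⟩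
        · exact Or.inr ⟨hc, h⟩
      · rintro (⟨hc, h⟩ | ⟨hc, h⟩) <;> exact ⟨hc, by omega⟩
    rw [hOC, Finset.sum_union]
    exact disjoint_left.mpr fun c h1 h2 => by
      have := (mem_filter.mp h1).2; have := (mem_filter.mp h2).2; omega
  -- closers are the images of openers under `σ`
  have hCO : ∑ c ∈ C, (G (extN σ c) c - G c c) = ∑ c ∈ O, (G c (c + 1) - G (c + 1) (c + 1)) := by
    refine Finset.sum_bij' (fun c _ => c - 1) (fun c _ => c + 1) ?_ ?_ ?_ ?_ ?_
    · intro c hc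
      obtain ⟨hcm, hcl⟩ := mem_filter.mp hc
      rw [mem_range] at hcm
      have h1 : 1 ≤ c := by omega
      have h2 := extN_extN hb hcm
      rw [hO, mem_filter, mem_range]
      refine ⟨by omega, ?_⟩
      have : extN σ c = c - 1 := by omega
      rw [this] at h2; rw [h2]; omega
    · intro c hc
      obtain ⟨hcm, hop⟩ := mem_filter.mp hc
      rw [mem_range] at hcm
      have hlt : c + 1 < m := by have := extN_lt σ hcm; omega
      rw [hC, mem_filter, mem_range]
      refine ⟨hlt, ?_⟩
      have h2 := extN_extN hb hcm
      rw [hop] at h2; rw [h2]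
    · intro c hc
      obtain ⟨hcm, hcl⟩ := mem_filter.mp hc
      omega
    · intro c hc; omega
    · intro c hc
      obtain ⟨hcm, hcl⟩ := mem_filter.mp hc
      rw [mem_range] at hcm
      have h1 : 1 ≤ c := by omega
      have : extN σ c = c - 1 := by omega
      rw [this, show c - 1 + 1 = c by omega]
  rw [hsplit, hCO, ← Finset.sum_add_distrib]
  -- openers correspond to the swap set via `c ↦ c + 1`
  refine Finset.sum_bij' (fun c _ => c + 1) (fun t _ => t - 1) ?_ ?_ ?_ ?_ ?_
  · intro c hc
    obtain ⟨hcm, hop⟩ := mem_filter.mp hc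
    rw [mem_range] at hcm
    have hlt : c + 1 < m := by have := extN_lt σ hcm; omega
    rw [mem_swapSet, Nat.add_sub_cancel]
    exact ⟨⟨by omega, by omega⟩, hop⟩
  · intro t ht
    obtain ⟨⟨h1, h2⟩, h3⟩ := mem_swapSet.mp ht
    rw [hO, mem_filter, mem_range]
    exact ⟨by omega, by rw [h3]; omega⟩
  · intro c hc; omega
  · intro t ht; obtain ⟨⟨h1, _⟩, _⟩ := mem_swapSet.mp ht; omega
  · intro c hc
    obtain ⟨hcm, hop⟩ := mem_filter.mp hc
    rw [hop]
    simp only [hG, itemSlope, itemIcpt, Nat.add_sub_cancel]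
    ring

end

end StaticTridiagonal

end Summit.ValiantsHypothesis.ValiantsHypothesis.Theorems.KPlusLogSqLaw
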